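import Literature.Geometry.Lorentzian.CarterConeArithmetic
import Literature.Geometry.Lorentzian.CarterFluxBookkeeping
import HarnessLib

/-!
# Bookkeeping for the threshold layer of the near-extremal cone: master variable, `Λ′ ≥ Λ/256`,
# near-extremality from `|a| ≥ a₁`, and `exp(c√Λ)` beats every polynomial
(namespace `Literature.Geometry.Lorentzian.Kerr`.)

Elementary size relations used to turn the explicit constants of the threshold/sliver kernel bounds
of Carter's equation (near-extremal Kerr, Breitenlohner–Freedman stable sectors, threshold layer
`|ω − mω₊| ≤ 2ξ₁κ`) into `C(M, θ, θ₁)·Λ^N·κ^{−N}`: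

* `layerMaster_bounds` — with `Y := 32(1 + M + M⁻¹)⁴(1 + θ⁻¹)(1 + θ₁⁻¹)·Λ/κ`, in the cone
  (`M/2 ≤ |a| < M`, admissible `(ω, m, Λ)`, `0 < m`, `|ω − mω₊| ≤ ε₀m`, `ε₀ ≤ 1/(16M)`):
  `1 ≤ Y`, `|ω| ≤ Y`, `|ω|⁻¹ ≤ Y`, `Λ ≤ Y`, `κ⁻¹ ≤ Y`, `M ≤ Y`, `M⁻¹ ≤ Y`, `(M²)⁻¹ ≤ Y`, `θ⁻¹ ≤ Y`,
  `θ₁⁻¹ ≤ Y`, `(r₊ − r₋)⁻¹ ≤ Y³` (no flux condition: `σ = 0` is allowed);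
* `freeMaster_bounds` — the κ-FREE master variable `Z := 32(1 + M + M⁻¹)⁴(1 + θ₁⁻¹)·Λ`:
  `1 ≤ Z`, `|ω| ≤ Z`, `|ω|⁻¹ ≤ Z`, `Λ ≤ Z`, `M ≤ Z`, `M⁻¹ ≤ Z`, `(M²)⁻¹ ≤ Z`, `θ₁⁻¹ ≤ Z`
  (for the depth condition, which must be discharged by `Λ ≥ Λ₀` uniformly in `κ`);
* `lambdaPrime_ge_of_margin` — in the cone with a Breitenlohner–Freedman margin
  `(1 + θ₁)(2r₊ω)² ≤ Λ′` (`θ₁ ≥ 0`): `Λ/256 ≤ Λ′ := Λ − 2amω` (so "`Λ′` large" follows from "`Λ` large");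
* `nearExtremal_of_abs_ge` — for `a₁ := M(1 − θ₁²/(128(1 + θ)²))` (`0 < θ₁ ≤ 1`, `0 < θ`):
  `M/2 ≤ a₁ < M`, and `a₁ ≤ |a| ≤ M` gives `r₊ − r₋ ≤ θ₁M/4` and `θ(r₊ − r₋) ≤ θ₁M/4`;
* `exists_forall_mul_pow_le_sinh` — for `c > 0`, real `C`, `N`: there is `Λ_d ≥ 1` with
  `CΛ^N ≤ sinh(c√Λ)` for all `Λ ≥ Λ_d` (`x^k/k! ≤ e^x`, `k = 2N + 2`).

## References
* M. Dafermos, I. Rodnianski, Y. Shlapentokh-Rothman, arXiv:1402.7034, §§2, 6 (frequency ranges);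
  key `DafermosRodnianskiShlapentokhrothman2014`. Folklore arithmetic.
-/

noncomputable section

open Set

namespace Literature.Geometry.Lorentzian

namespace Kerr

/-! ### The master variables -/

/-- Common core: `B = 1 + M + M⁻¹` dominates `1`, `M`, `M⁻¹`, and `MB ≥ 1`. [folklore] -/
private theorem base_bounds {M : ℝ} (hM : 0 < M) :
    1 ≤ 1 + M + M⁻¹ ∧ M ≤ 1 + M + M⁻¹ ∧ M⁻¹ ≤ 1 + M + M⁻¹ ∧ 1 ≤ M * (1 + M + M⁻¹) := by
  have hMi : 0 < M⁻¹ := inv_pos.2 hM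
  refine ⟨by linarith, by linarith, by linarith, ?_⟩
  have e : M * (1 + M + M⁻¹) = M + M ^ 2 + 1 := by field_simp
  rw [e]; nlinarith [sq_nonneg M]

/-- `r₊ − r₋ = 2(r₊² + a²)·κ` (`κ = (r₊ − r₋)/(2(r₊² + a²))`). [folklore] -/
theorem rPlus_sub_rMinus_eq_mul_surfaceGravity {M a : ℝ} (hM : 0 < M) :
    rPlus M a - rMinus M a = 2 * (rPlus M a ^ 2 + a ^ 2) * surfaceGravity M a := by
  rw [surfaceGravity_eq_rPlus_sub_rMinus_div]
  have : 0 < rPlus M a ^ 2 + a ^ 2 := by nlinarith [rPlus_pos hM a, sq_nonneg a]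
  field_simp

/-- `M² ≤ 2(r₊² + a²)` (`r₊ ≥ M`). [folklore] -/
theorem sq_le_two_mul_rPlus_sq_add_sq (M a : ℝ) (hM : 0 < M) : M ^ 2 ≤ 2 * (rPlus M a ^ 2 + a ^ 2) := by
  have h := M_le_rPlus M a
  nlinarith [sq_nonneg a, h, hM]

/-- **Frequency bounds in the cone without a flux condition**: `1/(16M) ≤ |ω| ≤ m/M ≤ Λ/M` and
`ω ≠ 0`. [cite: DafermosRodnianskiShlapentokhrothman2014, §6] -/
theorem cone_abs_omega_le_div {M a ω ε₀ Λ : ℝ} {m : ℤ} (hM : 0 < M) (haM : |a| ≤ M)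
    (ha : M / 2 ≤ |a|) (hadm : IsAdmissibleTriple a ω m Λ) (hm : 0 < m) (hε₀ : ε₀ ≤ 1 / (16 * M))
    (hcone : |ω - m * horizonAngularVelocity M a| ≤ ε₀ * |(m : ℝ)|) :
    1 / (16 * M) ≤ |ω| ∧ |ω| ≤ Λ / M ∧ ω ≠ 0 := by
  obtain ⟨hω16, hωle, -⟩ := cone_abs_omega_bounds hM haM ha hm hε₀ hcone
  have hm1 : (1 : ℝ) ≤ m := by exact_mod_cast hm
  have hmΛ : (m : ℝ) ≤ Λ := by nlinarith [hadm.sq_le]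
  refine ⟨hω16, hωle.trans (div_le_div_of_nonneg_right hmΛ hM.le), fun e ↦ ?_⟩
  rw [e, abs_zero] at hω16
  have : (0 : ℝ) < 1 / (16 * M) := by positivity
  linarith

/-- **Master variable of the threshold layer.** With `Y := 32(1 + M + M⁻¹)⁴(1 + θ⁻¹)(1 + θ₁⁻¹)·Λ/κ`,
in the cone (`M/2 ≤ |a| < M`, admissible `(ω, m, Λ)`, `0 < m`, `|ω − mω₊| ≤ ε₀m`, `ε₀ ≤ 1/(16M)`,
`0 < θ`, `0 < θ₁`): `1 ≤ Y`, `|ω| ≤ Y`, `|ω|⁻¹ ≤ Y`, `Λ ≤ Y`, `κ⁻¹ ≤ Y`, `M ≤ Y`, `M⁻¹ ≤ Y`,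
`(M²)⁻¹ ≤ Y`, `θ⁻¹ ≤ Y`, `θ₁⁻¹ ≤ Y`, `(r₊ − r₋)⁻¹ ≤ Y³`. [folklore] -/
theorem layerMaster_bounds {M a ω ε₀ θ θ₁ Λ : ℝ} {m : ℤ} (hMa : IsSubextremal M a) (ha : M / 2 ≤ |a|)
    (hadm : IsAdmissibleTriple a ω m Λ) (hm : 0 < m) (hε₀ : ε₀ ≤ 1 / (16 * M))
    (hcone : |ω - m * horizonAngularVelocity M a| ≤ ε₀ * |(m : ℝ)|) (hθ : 0 < θ) (hθ₁ : 0 < θ₁) :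
    let Y := 32 * (1 + M + M⁻¹) ^ 4 * (1 + θ⁻¹) * (1 + θ₁⁻¹) * Λ / surfaceGravity M a
    1 ≤ Y ∧ |ω| ≤ Y ∧ |ω|⁻¹ ≤ Y ∧ Λ ≤ Y ∧ (surfaceGravity M a)⁻¹ ≤ Y ∧ M ≤ Y ∧ M⁻¹ ≤ Y ∧
      (M ^ 2)⁻¹ ≤ Y ∧ θ⁻¹ ≤ Y ∧ θ₁⁻¹ ≤ Y ∧ (rPlus M a - rMinus M a)⁻¹ ≤ Y ^ 3 := by
  intro Y
  have hM : 0 < M := hMa.pos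
  have haM : |a| ≤ M := le_of_lt hMa
  set κ := surfaceGravity M a with hκdef
  have hκ : 0 < κ := hMa.surfaceGravity_pos
  have hκle : κ ≤ 1 / (4 * M) := surfaceGravity_le hM a
  obtain ⟨hB1, hBM, hBMi, hMB⟩ := base_bounds hM
  set B := 1 + M + M⁻¹ with hB
  have hMinv : 0 < M⁻¹ := inv_pos.2 hM
  have hB0 : 0 < B := by linarith
  have hB3 : B ≤ B ^ 3 := le_self_pow₀ hB1 (by norm_num)
  have hB23 : B ^ 2 ≤ B ^ 3 := pow_le_pow_right₀ hB1 (by norm_num)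
  have hB24 : B ^ 2 ≤ B ^ 4 := pow_le_pow_right₀ hB1 (by norm_num)
  have hB31 : (1 : ℝ) ≤ B ^ 3 := one_le_pow₀ hB1
  have hB41 : (1 : ℝ) ≤ B ^ 4 := one_le_pow₀ hB1
  have hB30 : 0 < B ^ 3 := pow_pos hB0 3
  have hB40 : 0 < B ^ 4 := pow_pos hB0 4
  have hθi : 0 < θ⁻¹ := inv_pos.2 hθ
  have hθ₁i : 0 < θ₁⁻¹ := inv_pos.2 hθ₁
  have hD1 : 1 ≤ (1 + θ⁻¹) * (1 + θ₁⁻¹) := one_le_mul_of_one_le_of_one_le (by linarith) (by linarith)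
  set A₀ := 32 * B ^ 4 * (1 + θ⁻¹) * (1 + θ₁⁻¹) with hA₀
  have hA32 : 32 * B ^ 4 ≤ A₀ := by
    rw [hA₀, mul_assoc (32 * B ^ 4)]; exact le_mul_of_one_le_right (by positivity) hD1
  -- admissibility: `1 ≤ m ≤ Λ`
  have hm1 : (1 : ℝ) ≤ m := by exact_mod_cast hm
  have hmΛ : (m : ℝ) ≤ Λ := by nlinarith [hadm.sq_le]
  have hΛ1 : 1 ≤ Λ := hm1.trans hmΛ
  -- `1/κ ≥ 4M`
  have hκinv : 4 * M ≤ κ⁻¹ := by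
    rw [le_inv_comm₀ (by positivity) hκ]; simpa [one_div] using hκle
  have hYdef : Y = A₀ * Λ * κ⁻¹ := by
    simp only [Y, hA₀, hB, div_eq_mul_inv]; rw [hκdef]
  clear_value Y
  have hY_A : A₀ * κ⁻¹ ≤ Y := by
    rw [hYdef]
    calc A₀ * κ⁻¹ = A₀ * 1 * κ⁻¹ := by ring
      _ ≤ A₀ * Λ * κ⁻¹ := by gcongr
  -- `A₀κ⁻¹ ≥ 128 B³ ≥ 1`
  have hAκ : 128 * B ^ 3 ≤ A₀ * κ⁻¹ := by
    calc 128 * B ^ 3 ≤ 128 * B ^ 3 * (M * B) := le_mul_of_one_le_right (by positivity) hMB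
      _ = 32 * B ^ 4 * (4 * M) := by ring
      _ ≤ A₀ * κ⁻¹ := mul_le_mul hA32 hκinv (by positivity) (by positivity)
  have hY_B : 128 * B ^ 3 ≤ Y := hAκ.trans hY_A
  have hYB3 : B ^ 3 ≤ Y := le_trans (by linarith [pow_pos hB0 3]) hY_B
  have hY1 : 1 ≤ Y := hB31.trans hYB3
  have hA1 : (1 : ℝ) ≤ A₀ := le_trans (by linarith only [hB41]) hA32
  have hκY : κ⁻¹ ≤ Y := by
    refine le_trans ?_ hY_A
    calc κ⁻¹ = 1 * κ⁻¹ := (one_mul _).symm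
      _ ≤ A₀ * κ⁻¹ := by gcongr
  have hAκ1 : 1 ≤ A₀ * κ⁻¹ := le_trans (by linarith [hB31]) hAκ
  have hΛY : Λ ≤ Y := by
    rw [hYdef]
    calc Λ = 1 * Λ := (one_mul _).symm
      _ ≤ (A₀ * κ⁻¹) * Λ := by gcongr
      _ = A₀ * Λ * κ⁻¹ := by ring
  have hMY : M ≤ Y := hBM.trans (hB3.trans hYB3)
  have hMiY : M⁻¹ ≤ Y := hBMi.trans (hB3.trans hYB3)
  have hM2Y : (M ^ 2)⁻¹ ≤ Y := by
    rw [← inv_pow]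
    exact (pow_le_pow_left₀ hMinv.le hBMi 2).trans (hB23.trans hYB3)
  have hΛMY : Λ * M⁻¹ ≤ Y := by
    rw [hYdef]
    have h1 : M⁻¹ ≤ A₀ * κ⁻¹ := by
      calc M⁻¹ = M⁻¹ * 1 := (mul_one _).symm
        _ ≤ M⁻¹ * (κ⁻¹ / (4 * M)) := by
            gcongr; rwa [le_div_iff₀ (by positivity), one_mul]
        _ = (M⁻¹) ^ 2 / 4 * κ⁻¹ := by field_simp
        _ ≤ B ^ 2 / 4 * κ⁻¹ := by gcongr
        _ ≤ A₀ * κ⁻¹ := by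
            gcongr
            calc B ^ 2 / 4 ≤ B ^ 4 := by linarith only [hB24, hB40]
              _ ≤ 32 * B ^ 4 := by linarith only [hB40]
              _ ≤ A₀ := hA32
    calc Λ * M⁻¹ ≤ Λ * (A₀ * κ⁻¹) := by gcongr
      _ = A₀ * Λ * κ⁻¹ := by ring
  -- `ω`
  obtain ⟨hω16, hωle, hω0'⟩ := cone_abs_omega_le_div hM haM ha hadm hm hε₀ hcone
  have hω0 : 0 < |ω| := abs_pos.2 hω0'
  have hωY : |ω| ≤ Y := by
    calc |ω| ≤ Λ / M := hωle
      _ = Λ * M⁻¹ := div_eq_mul_inv _ _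
      _ ≤ Y := hΛMY
  have hωiY : |ω|⁻¹ ≤ Y := by
    calc |ω|⁻¹ ≤ (1 / (16 * M))⁻¹ := by rw [inv_le_inv₀ hω0 (by positivity)]; exact hω16
      _ = 16 * M := by rw [one_div, inv_inv]
      _ ≤ 128 * B ^ 3 := by linarith only [hBM.trans hB3, hB30]
      _ ≤ Y := hY_B
  -- `θ⁻¹`, `θ₁⁻¹`: `A₀κ⁻¹ ≥ 128B³(1 + θ⁻¹)(1 + θ₁⁻¹) ≥ (1 + θ⁻¹)(1 + θ₁⁻¹)`
  have hAκ' : (1 + θ⁻¹) * (1 + θ₁⁻¹) ≤ A₀ * κ⁻¹ := by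
    calc (1 + θ⁻¹) * (1 + θ₁⁻¹) ≤ 128 * B ^ 3 * ((1 + θ⁻¹) * (1 + θ₁⁻¹)) :=
          le_mul_of_one_le_left (by positivity) (by linarith only [hB31])
      _ ≤ 128 * B ^ 3 * (M * B) * ((1 + θ⁻¹) * (1 + θ₁⁻¹)) :=
          mul_le_mul_of_nonneg_right (le_mul_of_one_le_right (by positivity) hMB) (by positivity)
      _ = A₀ * (4 * M) := by rw [hA₀]; ring
      _ ≤ A₀ * κ⁻¹ := by gcongr
  have hθY : θ⁻¹ ≤ Y := by
    refine le_trans ?_ (hAκ'.trans hY_A)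
    calc θ⁻¹ ≤ 1 + θ⁻¹ := by linarith only
      _ = (1 + θ⁻¹) * 1 := (mul_one _).symm
      _ ≤ (1 + θ⁻¹) * (1 + θ₁⁻¹) := by gcongr; linarith only [hθ₁i]
  have hθ₁Y : θ₁⁻¹ ≤ Y := by
    refine le_trans ?_ (hAκ'.trans hY_A)
    calc θ₁⁻¹ ≤ 1 + θ₁⁻¹ := by linarith only
      _ = 1 * (1 + θ₁⁻¹) := (one_mul _).symm
      _ ≤ (1 + θ⁻¹) * (1 + θ₁⁻¹) := by gcongr; linarith only [hθi]
  -- `(r₊ − r₋)⁻¹ = (2κ(r₊² + a²))⁻¹ ≤ κ⁻¹ (M²)⁻¹ ≤ Y·Y ≤ Y³`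
  have hdY : (rPlus M a - rMinus M a)⁻¹ ≤ Y ^ 3 := by
    have hd : rPlus M a - rMinus M a = 2 * (rPlus M a ^ 2 + a ^ 2) * κ :=
      rPlus_sub_rMinus_eq_mul_surfaceGravity hM
    have hA : M ^ 2 ≤ 2 * (rPlus M a ^ 2 + a ^ 2) := sq_le_two_mul_rPlus_sq_add_sq M a hM
    rw [hd, mul_inv]
    calc (2 * (rPlus M a ^ 2 + a ^ 2))⁻¹ * κ⁻¹ ≤ (M ^ 2)⁻¹ * κ⁻¹ := by
          gcongr
      _ ≤ Y * Y := mul_le_mul hM2Y hκY (by positivity) (by positivity)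
      _ = Y ^ 2 * 1 := by ring
      _ ≤ Y ^ 2 * Y := by gcongr
      _ = Y ^ 3 := by ring
  exact ⟨hY1, hωY, hωiY, hΛY, hκY, hMY, hMiY, hM2Y, hθY, hθ₁Y, hdY⟩
set_option maxHeartbeats 400000 in -- buildfix (bf3-g27): 160k/180k FAIL, 200k PASS at accept time; line-neutral budget line
/-- **The κ-free master variable.** With `Z := 32(1 + M + M⁻¹)⁴(1 + θ₁⁻¹)·Λ`, in the cone:
`1 ≤ Z`, `|ω| ≤ Z`, `|ω|⁻¹ ≤ Z`, `Λ ≤ Z`, `M ≤ Z`, `M⁻¹ ≤ Z`, `(M²)⁻¹ ≤ Z`, `θ₁⁻¹ ≤ Z`. [folklore] -/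
theorem freeMaster_bounds {M a ω ε₀ θ₁ Λ : ℝ} {m : ℤ} (hM : 0 < M) (haM : |a| ≤ M) (ha : M / 2 ≤ |a|)
    (hadm : IsAdmissibleTriple a ω m Λ) (hm : 0 < m) (hε₀ : ε₀ ≤ 1 / (16 * M))
    (hcone : |ω - m * horizonAngularVelocity M a| ≤ ε₀ * |(m : ℝ)|) (hθ₁ : 0 < θ₁) :
    let Z := 32 * (1 + M + M⁻¹) ^ 4 * (1 + θ₁⁻¹) * Λ
    1 ≤ Z ∧ |ω| ≤ Z ∧ |ω|⁻¹ ≤ Z ∧ Λ ≤ Z ∧ M ≤ Z ∧ M⁻¹ ≤ Z ∧ (M ^ 2)⁻¹ ≤ Z ∧ θ₁⁻¹ ≤ Z := by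
  intro Z
  obtain ⟨hB1, hBM, hBMi, hMB⟩ := base_bounds hM
  set B := 1 + M + M⁻¹ with hB
  have hMinv : 0 < M⁻¹ := inv_pos.2 hM
  have hB0 : 0 < B := by linarith
  have hB4 : B ≤ B ^ 4 := le_self_pow₀ hB1 (by norm_num)
  have hB24 : B ^ 2 ≤ B ^ 4 := pow_le_pow_right₀ hB1 (by norm_num)
  have hB41 : (1 : ℝ) ≤ B ^ 4 := one_le_pow₀ hB1
  have hθ₁i : 0 < θ₁⁻¹ := inv_pos.2 hθ₁
  have hm1 : (1 : ℝ) ≤ m := by exact_mod_cast hm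
  have hmΛ : (m : ℝ) ≤ Λ := by nlinarith [hadm.sq_le]
  have hΛ1 : 1 ≤ Λ := hm1.trans hmΛ
  set A := 32 * B ^ 4 * (1 + θ₁⁻¹) with hA
  have hA32 : 32 * B ^ 4 ≤ A := le_mul_of_one_le_right (by positivity) (by linarith)
  have hZdef : Z = A * Λ := by simp only [Z, hA, hB]
  clear_value Z
  have hAZ : A ≤ Z := by rw [hZdef]; exact le_mul_of_one_le_right (by positivity) hΛ1
  have hB4Z : B ^ 4 ≤ Z := le_trans (by nlinarith [pow_pos hB0 4]) (hA32.trans hAZ)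
  have hZ1 : 1 ≤ Z := hB41.trans hB4Z
  have hΛZ : Λ ≤ Z := by
    rw [hZdef]; exact le_mul_of_one_le_left (by linarith) (le_trans (by nlinarith [hB41]) hA32)
  obtain ⟨hω16, hωle, hω0'⟩ := cone_abs_omega_le_div hM haM ha hadm hm hε₀ hcone
  have hω0 : 0 < |ω| := abs_pos.2 hω0'
  have hωZ : |ω| ≤ Z := by
    calc |ω| ≤ Λ / M := hωle
      _ = Λ * M⁻¹ := div_eq_mul_inv _ _
      _ ≤ Λ * A := by
          gcongr
          calc M⁻¹ ≤ B := hBMi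
            _ ≤ B ^ 4 := hB4
            _ ≤ 32 * B ^ 4 := by nlinarith [pow_pos hB0 4]
            _ ≤ A := hA32
      _ = Z := by rw [hZdef]; ring
  have hωiZ : |ω|⁻¹ ≤ Z := by
    calc |ω|⁻¹ ≤ (1 / (16 * M))⁻¹ := by rw [inv_le_inv₀ hω0 (by positivity)]; exact hω16
      _ = 16 * M := by rw [one_div, inv_inv]
      _ ≤ 32 * B ^ 4 := by nlinarith [hBM.trans hB4, pow_pos hB0 4]
      _ ≤ Z := hA32.trans hAZ
  refine ⟨hZ1, hωZ, hωiZ, hΛZ, hBM.trans (hB4.trans hB4Z), hBMi.trans (hB4.trans hB4Z), ?_, ?_⟩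
  · rw [← inv_pow]; exact (pow_le_pow_left₀ hMinv.le hBMi 2).trans (hB24.trans hB4Z)
  · calc θ₁⁻¹ ≤ 1 + θ₁⁻¹ := by linarith only
      _ ≤ 32 * B ^ 4 * (1 + θ₁⁻¹) :=
          le_mul_of_one_le_left (by positivity) (by linarith only [hB41])
      _ = A := by rw [hA]
      _ ≤ Z := hAZ

/-! ### `Λ′ ≥ Λ/256` in the cone with a Breitenlohner–Freedman margin -/

/-- **`Λ′ ≥ Λ/256`.** In the cone (`M/2 ≤ |a| ≤ M`, `0 < m`,
`|ω − mω₊| ≤ ε₀m`, `ε₀ ≤ 1/(16M)`) with `(1 + θ₁)(2r₊ω)² ≤ Λ − 2amω`, `θ₁ ≥ 0`: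
`Λ/256 ≤ Λ − 2amω` (if `Λ ≥ 4m²` then `Λ − 2amω ≥ Λ − 2m² ≥ Λ/2`; otherwise
`Λ − 2amω ≥ (2r₊ω)² ≥ (2M·m/(16M))² = m²/64 > Λ/256`). [folklore] -/
theorem lambdaPrime_ge_of_margin {M a ω ε₀ θ₁ Λ : ℝ} {m : ℤ} (hM : 0 < M) (haM : |a| ≤ M)
    (ha : M / 2 ≤ |a|) (hm : 0 < m) (hε₀ : ε₀ ≤ 1 / (16 * M))
    (hcone : |ω - m * horizonAngularVelocity M a| ≤ ε₀ * |(m : ℝ)|) (hθ₁ : 0 ≤ θ₁)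
    (hBF : (1 + θ₁) * (2 * rPlus M a * ω) ^ 2 ≤ Λ - 2 * a * m * ω) :
    Λ / 256 ≤ Λ - 2 * a * m * ω := by
  obtain ⟨hω16, hωle, -⟩ := cone_abs_omega_bounds hM haM ha hm hε₀ hcone
  have hm1 : (1 : ℝ) ≤ m := by exact_mod_cast hm
  have hm0 : (0 : ℝ) < m := by linarith
  have hrp : M ≤ rPlus M a := M_le_rPlus M a
  -- `|2amω| ≤ 2 m²`
  have h2 : |2 * a * m * ω| ≤ 2 * (m : ℝ) ^ 2 := by
    rw [abs_mul, abs_mul, abs_mul, abs_of_pos (by norm_num : (0:ℝ) < 2), abs_of_pos hm0]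
    have : |a| * |ω| ≤ M * (m / M) := mul_le_mul haM hωle (abs_nonneg _) hM.le
    rw [mul_div_cancel₀ _ hM.ne'] at this
    nlinarith [this, abs_nonneg a, abs_nonneg ω]
  rcases le_or_gt (4 * (m : ℝ) ^ 2) Λ with h | h
  · have : -(2 * (m:ℝ) ^ 2) ≤ -(2 * a * m * ω) := by linarith [(abs_le.1 h2).2]
    have hm2 : 0 ≤ (m : ℝ) ^ 2 := sq_nonneg _
    linarith
  · -- `Λ′ ≥ (2r₊ω)² ≥ (2M|ω|)² ≥ (m/8)² = m²/64`
    have h3 : (2 * rPlus M a * ω) ^ 2 ≤ Λ - 2 * a * m * ω := by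
      have : (2 * rPlus M a * ω) ^ 2 ≤ (1 + θ₁) * (2 * rPlus M a * ω) ^ 2 :=
        le_mul_of_one_le_left (sq_nonneg _) (by linarith)
      exact this.trans hBF
    have h4 : ((m : ℝ) / 8) ^ 2 ≤ (2 * rPlus M a * ω) ^ 2 := by
      have e : (2 * rPlus M a * ω) ^ 2 = (2 * rPlus M a * |ω|) ^ 2 := by
        rw [mul_pow, mul_pow (2 * rPlus M a), sq_abs]
      rw [e]
      refine pow_le_pow_left₀ (by positivity) ?_ 2
      -- `m/8 ≤ 2 r₊ |ω|`: `|ω| ≥ m/(16M)`… we only have `|ω| ≥ 1/(16M)`; use `|ω| ≥ |mω₊| − |σ|`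
      have hlow := le_abs_horizonAngularVelocity hM ha
      have hσ : |ω - m * horizonAngularVelocity M a| ≤ m / (16 * M) := by
        calc _ ≤ ε₀ * |(m:ℝ)| := hcone
          _ ≤ 1 / (16 * M) * |(m:ℝ)| := mul_le_mul_of_nonneg_right hε₀ (abs_nonneg _)
          _ = m / (16 * M) := by rw [abs_of_pos hm0]; ring
      have h5 : (m : ℝ) * (1 / (8 * M)) ≤ |m * horizonAngularVelocity M a| := by
        rw [abs_mul, abs_of_pos hm0]; exact mul_le_mul_of_nonneg_left hlow hm0.le
      have h6 : |(m : ℝ) * horizonAngularVelocity M a| - |ω - m * horizonAngularVelocity M a| ≤ |ω| := by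
        have := abs_sub_abs_le_abs_sub ((m : ℝ) * horizonAngularVelocity M a)
          (m * horizonAngularVelocity M a - ω)
        rw [sub_sub_cancel, abs_sub_comm] at this
        linarith
      have h7 : (m : ℝ) / (16 * M) ≤ |ω| := by
        have e : (m : ℝ) * (1 / (8 * M)) - m / (16 * M) = m / (16 * M) := by field_simp; ring
        linarith
      calc (m : ℝ) / 8 = 2 * M * (m / (16 * M)) := by field_simp; ring
        _ ≤ 2 * rPlus M a * |ω| := mul_le_mul (by linarith) h7 (by positivity) (by linarith [hM, hrp])
    have e : ((m : ℝ) / 8) ^ 2 = m ^ 2 / 64 := by ring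
    rw [e] at h4
    linarith

/-! ### Near extremality from `|a| ≥ a₁` -/

/-- **Near-extremality from `|a| ≥ a₁`.** For `0 < M`, `0 < θ`, `0 < θ₁ ≤ 1` put
`a₁ := M(1 − θ₁²/(128(1 + θ)²))`. Then `M/2 ≤ a₁ < M`, and for every `a` with `a₁ ≤ |a| ≤ M`:
`r₊ − r₋ ≤ θ₁M/4` and `θ(r₊ − r₋) ≤ θ₁M/4` (`r₊ − r₋ = 2√(M² − a²)`). [folklore] -/
theorem nearExtremal_of_abs_ge {M θ θ₁ : ℝ} (hM : 0 < M) (hθ : 0 < θ) (hθ₁ : 0 < θ₁) (hθ₁1 : θ₁ ≤ 1) :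
    M / 2 ≤ M * (1 - θ₁ ^ 2 / (128 * (1 + θ) ^ 2)) ∧ M * (1 - θ₁ ^ 2 / (128 * (1 + θ) ^ 2)) < M ∧
    ∀ a : ℝ, M * (1 - θ₁ ^ 2 / (128 * (1 + θ) ^ 2)) ≤ |a| → |a| ≤ M →
      rPlus M a - rMinus M a ≤ θ₁ * M / 4 ∧ θ * (rPlus M a - rMinus M a) ≤ θ₁ * M / 4 := by
  set ε := θ₁ ^ 2 / (128 * (1 + θ) ^ 2) with hε
  have hε0 : 0 < ε := by positivity
  have hε1 : ε ≤ 1 / 128 := by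
    rw [hε, div_le_div_iff₀ (by positivity) (by norm_num)]
    have h1 : θ₁ ^ 2 ≤ 1 := pow_le_one₀ hθ₁.le hθ₁1
    have h2 : (1 : ℝ) ≤ (1 + θ) ^ 2 := by nlinarith
    nlinarith
  refine ⟨by nlinarith, by nlinarith, fun a ha haM ↦ ?_⟩
  -- `M² − a² ≤ 2εM²`
  have ha0 : 0 ≤ |a| := abs_nonneg a
  have h1 : M ^ 2 - a ^ 2 ≤ 2 * ε * M ^ 2 := by
    have h2 : (M * (1 - ε)) ^ 2 ≤ |a| ^ 2 := pow_le_pow_left₀ (by nlinarith) ha 2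
    rw [sq_abs] at h2
    nlinarith [h2, sq_nonneg (M * ε)]
  have hd : rPlus M a - rMinus M a = 2 * Real.sqrt (M ^ 2 - a ^ 2) := rPlus_sub_rMinus M a
  -- `2√(M² − a²) ≤ θ₁M/(4(1 + θ))`
  have h3 : 2 * Real.sqrt (M ^ 2 - a ^ 2) ≤ θ₁ * M / (4 * (1 + θ)) := by
    have h4 : Real.sqrt (M ^ 2 - a ^ 2) ≤ θ₁ * M / (8 * (1 + θ)) := by
      rw [Real.sqrt_le_left (by positivity)]
      calc M ^ 2 - a ^ 2 ≤ 2 * ε * M ^ 2 := h1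
        _ = (θ₁ * M / (8 * (1 + θ))) ^ 2 := by rw [hε]; field_simp; ring
    have e : θ₁ * M / (4 * (1 + θ)) = 2 * (θ₁ * M / (8 * (1 + θ))) := by field_simp; ring
    rw [e]; linarith
  have h5 : θ₁ * M / (4 * (1 + θ)) ≤ θ₁ * M / 4 :=
    div_le_div_of_nonneg_left (by positivity) (by norm_num) (by linarith)
  have h6 : θ * (θ₁ * M / (4 * (1 + θ))) ≤ θ₁ * M / 4 := by
    rw [mul_div_assoc', div_le_div_iff₀ (by positivity) (by norm_num)]
    nlinarith [mul_pos hθ₁ hM]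
  rw [hd]
  exact ⟨h3.trans h5, (mul_le_mul_of_nonneg_left h3 hθ.le).trans h6⟩

/-! ### `exp(c√Λ)` beats every polynomial -/

/-- **`CΛ^N ≤ sinh(c√Λ)` for `Λ` large.** For `c > 0`, real `C` and `N : ℕ` there is `Λ_d ≥ 1` such that
`C·Λ^N ≤ sinh(c·√Λ)` for all `Λ ≥ Λ_d` (with `k = 2N + 2`: `sinh x ≥ (e^x − 1)/2 ≥ (x^k/k! − 1)/2`,
`x^k = c^kΛ^{N+1}`). [folklore] -/
theorem exists_forall_mul_pow_le_sinh {c C : ℝ} (hc : 0 < c) (N : ℕ) :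
    ∃ Λd : ℝ, 1 ≤ Λd ∧ ∀ Λ : ℝ, Λd ≤ Λ → C * Λ ^ N ≤ Real.sinh (c * Real.sqrt Λ) := by
  set k := 2 * N + 2 with hk
  have hkf : (0 : ℝ) < k.factorial := by exact_mod_cast Nat.factorial_pos k
  have hck : 0 < c ^ k := pow_pos hc k
  refine ⟨max 1 (k.factorial * (2 * C + 1) / c ^ k), le_max_left _ _, fun Λ hΛ ↦ ?_⟩
  have hΛ1 : 1 ≤ Λ := le_trans (le_max_left _ _) hΛ
  have hΛ0 : 0 ≤ Λ := by linarith
  have hΛd : k.factorial * (2 * C + 1) / c ^ k ≤ Λ := le_trans (le_max_right _ _) hΛ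
  set x := c * Real.sqrt Λ with hx
  have hx0 : 0 ≤ x := by positivity
  -- `x^k = c^k Λ^{N+1}`
  have hxk : x ^ k = c ^ k * Λ ^ (N + 1) := by
    rw [hx, mul_pow]
    congr 1
    rw [hk, show 2 * N + 2 = 2 * (N + 1) by ring, pow_mul, Real.sq_sqrt hΛ0]
  -- `e^x ≥ x^k/k!`
  have hexp : x ^ k / k.factorial ≤ Real.exp x := Real.pow_div_factorial_le_exp x hx0 k
  -- `sinh x ≥ (e^x − 1)/2`
  have hsinh : (Real.exp x - 1) / 2 ≤ Real.sinh x := by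
    rw [Real.sinh_eq]
    have : Real.exp (-x) ≤ 1 := by rw [Real.exp_le_one_iff]; linarith
    linarith
  -- `x^k/k! ≥ (2C + 1) Λ^N ≥ 2CΛ^N + 1`
  have hmain : 2 * C * Λ ^ N + 1 ≤ x ^ k / k.factorial := by
    rw [hxk, le_div_iff₀ hkf]
    have h1 : k.factorial * (2 * C + 1) ≤ c ^ k * Λ := by
      have := (div_le_iff₀ hck).1 hΛd
      rwa [mul_comm Λ] at this
    have hΛN : 1 ≤ Λ ^ N := one_le_pow₀ hΛ1
    have h2 := mul_le_mul_of_nonneg_right h1 (zero_le_one.trans hΛN)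
    calc (2 * C * Λ ^ N + 1) * k.factorial ≤ (2 * C * Λ ^ N + Λ ^ N) * k.factorial := by
          gcongr
      _ = k.factorial * (2 * C + 1) * Λ ^ N := by ring
      _ ≤ c ^ k * Λ * Λ ^ N := h2
      _ = c ^ k * Λ ^ (N + 1) := by ring
  linarith

end Kerr

end Literature.Geometry.Lorentzian

end
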